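import Summits.QuantumFields.BalabanUV.T4Continuum.Spine.NE1p.DressedSmallFieldInnerCount
import Summits.QuantumFields.BalabanUV.T4Continuum.Spine.NE1p.DressedSmallFieldGeometryFaces

/-!
# T⁴ programme, spine estimate NE1′ (node O3b/H2) — THE (2.27)∘(2.32) LINK OF THE SECOND RESUMMATION STEP IS (2.27) ON THE
# AUGMENTED FAMILY: the owner's displayed binder `hlink` of N0u `DressedSmallFieldInnerCount` DISCHARGED at `c₃₂ = 5 + u₀` on every
# (2.11)-geometry whose cubes are footprints of unit domains of size `≤ u₀` — by the geometry's OWN (2.27) FIELD `Geometry.ineq227`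
# applied to the family enlarged by the uncovered cubes — and at `c₃₂ = 5` on pv22's torus (uniformly in the side `N` and the
# dimension `d`; 5 is SHARP for the inequality as typed); N0u's inner-label END re-fired ONCE WITHOUT the link binder, abstract and
# on the torus of the papers

Cell `pub-balaban`, sub-cell `t4`, BINDER-OWNERS row NE1′ (owner lineage t4-ne1p-p1), crew `b2b-balaban-t4-ne1p-formalise-*`, seat
`…-leaf-07` (LEAF PROVER 07, gen 16; lineage S3c ∕ W4 ∕ S1f ∕ S3c.1 ∕ W16); crew row **S40 PART 1** ∕ DAG N29zzl (INTENT `HOME/CLAIMS.log`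
l.19085, PROTOTYPE l.19300, ADDENDUM l.19407; BOOKED typer gen 6 R-T125 (iii) l.19575, (D1) two parts — PART 2 = `DressedSmallFieldOuterLink`;
cross-read X157; dagwriter R-Q47 (w-ii), T4-DAG v45 §8).  ADDITIVE — imports the owner's N0u `Spine/NE1p/DressedSmallFieldInnerCount`
(`attachedPart_locE_le_of_coresAt_pencil_innerLabels`; → N0t → N0s → N0r → …; b13's `B13FamilySum.coveringFamilies` and pv22's
`TreeLengthTorus` ∕ `TreeLengthTorusGeometry` in the cone) and crew row S24 `Spine/NE1p/DressedSmallFieldGeometryFaces` (`K₀_four`; N0o's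
`torus_consts` through it) ONLY; THEOREMS ONLY (0 def, 0 `def … : Prop`, 0 cite); nothing of N0u ∕ N0s ∕ b13's ∕ pv22's modules is
restated — their declarations are used BY NAME.

WHY THIS FILE.  N0u (the SECOND of print's four resummation steps, [Balaban1988RGII] pp. 17–19, table-blind) indexes the terms of a
polymer `Z` by inner labels `⟨W, (𝐃, P)⟩` of the scale-`k` domain `Z₀ = foot Z` — uncovered cubes `W ⊆ cubes Z₀`, a Mayer subfamily `𝐃`
covering `cubes Z₀ ∖ W` EXACTLY, a bond set `P ⊆ bondsOf W` with `#W ≤ 2·#P` — and DISPLAYS, besides the amplitude `hAmp`, the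
admissibility `hadm`, the bonds-per-cube clause `hb₀` and the numeric clauses, ONE GEOMETRIC binder: the «(2.27)∘(2.32)-KIND link»
  `hlink : ∀ Z, ∀ W ⊆ Gk.cubes (foot Z), ∀ Df ∈ coveringFamilies univ Gk.cubes (Gk.cubes (foot Z) \ W),
             Dk.dj (foot Z) + 5 ≤ ∑ Y ∈ Df, (Dk.dj Y + 5) + c₃₂ * W.card`
(owner: «print's (2.32) constant `4`, the tree's repaired `17` for the formalised tree length, G-B13-08»).  AS TYPED this link needs NO
(2.32): if `Df` covers `cubes Z₀ ∖ W` exactly, then `Df ∪ {unit c : c ∈ W}` — the uncovered cubes ADJOINED AS UNIT DOMAINS — covers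
`cubes Z₀` exactly, so the geometry's own (2.27) (`Geometry.ineq227`, constant 5 — a FIELD of `B13Resummation.Geometry`, PROVED on the
torus by pv22's `ineq227_tcubes`) gives `d(Z₀) + 5 ≤ Σ_{Y∈Df}(d Y + 5) + Σ_{c∈W}(d(unit c) + 5) ≤ Σ_{Y∈Df}(d Y + 5) + (5 + u₀)·#W`
whenever `cubes (unit c) = {c}` and `d(unit c) ≤ u₀`.  On pv22's torus `tsys d N` ∕ `tgeometry d N` a single cube IS a localization domain
of tree length `0` (`torusTreeLen_singleton`), so `c₃₂ = 5`, uniformly in `N` and `d`, and `5` cannot be lowered (at a one-cube domain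
with its cube uncovered and the empty family the link reads `0 + 5 ≤ 0 + c₃₂·1`).
* §1 `augmented_mem_coveringFamilies` (finite-set algebra) and **`link_of_ineq227`** — the link at `c₃₂ := 5 + u₀` on an abstract
  `Gk : Geometry Dk CubeK` with unit domains `unit : CubeK → Dk.Dom` (`hcubes`, `hu₀`); `link_of_ineq227'` — the same in the
  arrangement `d(Z₀) − c'·#W + 5 ≤ Σ …` that the owner's N0v (third∕fourth steps, on `G` itself) displays.
* §2 **`link_torus`** ∕ `link_torus'` — N0u's ∕ N0v's `hlink` SHAPES on `tsys d N` at `c₃₂ = c' = 5`, NO hypothesis;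
  **`link_torus_const_sharp`** — for every `c < 5` the shape FAILS (decided counterexample, in kernel).
* §3 **`attachedPart_locE_le_of_coresAt_pencil_innerLabels_of_units`** — N0u's END ONCE BY NAME, every binder VERBATIM except
  `hlink ↦ (unit, hcubes, hu₀)` and `c₃₂ ↦ 5 + u₀` inside the rate bookkeeping `hRR` (`u := e^{R(5+u₀)}·s·e^{b₀t}`).
* §4 **`attachedPart_locE_le_of_coresAt_pencil_innerLabels_torus`** — §3 at `D = Dk := tsys 4 N`, `G = Gk := tgeometry 4 N`, `foot := id`,
  unit domains the single cubes: NO link binder, NO geometry hypothesis, NO `hmono`; pv22's located letters by N0o's `torus_consts` ∕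
  S24's `K₀_four` (`64·log 162 + 1 ≤ δκ`, `e·K₀(64,8)·64·α₆ ≤ 1`, `r₁ + 2·(64 log 162) + 2 ≤ Rkp ≤ R − 64·(e^{5R}·s·e^{b₀t})`,
  `(A₀ + ϱA₁)·e^{5r₁+1}·K₀(64,8)·9·64 ≤ 1`); conclusion in the crew's torus currency (S25–S29, S34).

WHAT IS LOCATED (crew reading; the dagwriter's RULING R-Q47 (T4-DAG v45 §8, (w-ii)) names this module as the STRUCTURAL supplier of
the Y₀∕P-step's link on ACCEPT + outside read; nothing of the owner's is re-labelled).  The second resummation step's link, as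
the cell types it, costs (2.27) only; print's (2.32) («Σ_i d_k(Y_i) + 4M⁻⁴|Z₀∖Y₀| ≥ d_k(Z₀)», FALSE with `4`, GAPS G-B13-08; the tree's
N-uniform substitute `B13Ineq232TreeLength.ineq232_treeLen_four` with `17` for `treeLen` on DISJOINT wall-free components) is NOT on
N0u's path — it stays needed only where print's own `d_k(Z₀)`-bookkeeping of (2.33) is followed, which the cell's format does not do.
The rate letter `u = e^{R c₃₂}·s·e^{b₀t}` of N0u's `hRR` is therefore read at `c₃₂ = 5` on the torus: `Rkp ≤ R − 64·e^{5R}·s·e^{b₀t}`.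

WORDING OF RECORD (crew row S40 = DAG N29zzl, typer gen 6 R-T125 (iii), (D1) two parts; cross-read X157; the typer's rider, ADOPTED
VERBATIM): «(2.27) is the Geometry FIELD `ineq227` used BY NAME; `c₃₂ = 5` (and the `+u₀` relative form) is the typed constant of OUR
link SHAPE on geometries whose cubes are unit domains; print's 4∕5∕17∕«½M⁻⁴» are TYPE∕CONTEXT only; (2.32)∕(2.36)–(2.37)∕(1.28) stay
DISPLAYED».

HONEST FRAMING (c3∕c4∕c6∕k1–k3).  Finite-set algebra + one by-name application of the owner's END over hypothesis SHAPES; (2.27) is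
the `Geometry` FIELD (pv22's theorem on the torus), used BY NAME — no numeral of [Balaban1988RGII] is asserted (print's `4` ∕ `5` ∕ the
tree's `17` are TYPE∕CONTEXT words; the `5` of §1∕§2 is (2.27)'s typed constant); `hadm` ∕ `hAmp` ∕ `hb₀` ∕ `bondsOf` ∕ the clauses
stay DISPLAYED exactly as N0u displays them — (B1b)-READING identifications and (B3)∕(B5)-KIND letters; (B1)∕(B3)∕(B5) for Bałaban's
(2.14) objects NOT discharged; 0 binders instantiated on Bałaban's densities; no wall item; wall v1.7 (T4-DAG v45) does NOT move;
R-t4r2-Q2 NOT met thereby; NE1′ ⇐ the named binders — NOT proved, NOT printed; spine PROVED 0∕9; count 9 unchanged.  [folklore] ∕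
[decided toy] tags on kernel lemmas only; no placeholders; no citations (bracketed names are labels); no internally-minted statement
becomes a cited fact (ABSOLUTE RULE).  Rung (B)+1 on ONE finite four-torus — NOT infinite volume, NOT a mass gap, NOT OS on ℝ⁴, NOT
Clay.  HONEST DEPENDENCY: continuum YM on T⁴ ⇐ BetaPertH ∧ nine spine estimates (0/9 proved); BetaPertH ⇐ (D1) ∧ (D4) ∧ CAP+tail;
G-an2-4 gates asym, D1 and NE2/3/4. -/
noncomputable section

namespace Summit.QuantumFields.BalabanUV.T4Continuum.NE1p.DressedSmallFieldInnerLink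

open Metric Set Complex MeasureTheory
open scoped BigOperators
open Literature.MathematicalPhysics.QuantumFieldTheory.Balaban1983to89 (LocDomainSys)
open Literature.MathematicalPhysics.QuantumFieldTheory.Balaban1983to89.B13FamilySum (coveringFamilies mem_coveringFamilies)
open Literature.MathematicalPhysics.QuantumFieldTheory.Balaban1983to89.T4OutputRate (Carriers)
open Literature.MathematicalPhysics.QuantumFieldTheory.Balaban1983to89.B13Resummation (locE Geometry)
open Literature.MathematicalPhysics.QuantumFieldTheory.Balaban1983to89.B12TreeDecay (K₀)
open Literature.MathematicalPhysics.QuantumFieldTheory.Balaban1983to89.TreeLengthTorus (TPt TDom IsTDom tsys torusTreeLen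
  torusTreeLen_singleton)
open Literature.MathematicalPhysics.QuantumFieldTheory.Balaban1983to89.TreeLengthTorusGeometry (TTouch tgeometry)
open Summit.QuantumFields.BalabanUV.T4Continuum.B13HistMeasurable (MeasPotFrame B13HistM)
open Summit.QuantumFields.BalabanUV.T4Continuum.B13TermParamGaussianBi (BiCore)
open Summit.QuantumFields.BalabanUV.T4Continuum.NE1p.DressedSmallFieldGeometry (torus_consts)
open Summit.QuantumFields.BalabanUV.T4Continuum.NE1p.DressedSmallFieldGeometryFaces (K₀_four)
open Summit.QuantumFields.BalabanUV.T4Continuum.NE1p.DressedSmallFieldInnerCount (attachedPart_locE_le_of_coresAt_pencil_innerLabels)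

/-! ## §1 THE LINK IS (2.27) ON THE AUGMENTED FAMILY -/

section Link

variable {Dk : LocDomainSys} {CubeK : Type} [DecidableEq CubeK] (Gk : Geometry Dk CubeK)

/-- **THE AUGMENTED FAMILY COVERS THE WHOLE FOOTPRINT** [folklore]: if `W ⊆ cubes Z₀` and the family `Df` covers `cubes Z₀ ∖ W`
exactly, then `Df` together with the uncovered cubes ADJOINED AS UNIT DOMAINS (`cubes (unit c) = {c}`) covers `cubes Z₀` exactly —
a member of (2.29)'s index set `coveringFamilies univ cubes (cubes Z₀)`. -/
theorem augmented_mem_coveringFamilies [DecidableEq Dk.Dom] (unit : CubeK → Dk.Dom) (hcubes : ∀ c, Gk.cubes (unit c) = {c}) {Z₀ : Dk.Dom}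
    {W : Finset CubeK} (hW : W ⊆ Gk.cubes Z₀) {Df : Finset Dk.Dom}
    (hDf : Df ∈ coveringFamilies Finset.univ Gk.cubes (Gk.cubes Z₀ \ W)) :
    Df ∪ W.image unit ∈ coveringFamilies Finset.univ Gk.cubes (Gk.cubes Z₀) := by
  classical
  rw [mem_coveringFamilies] at hDf ⊢
  refine ⟨Finset.subset_univ _, ?_⟩
  have hWW : (W.image unit).biUnion Gk.cubes = W := by
    rw [Finset.image_biUnion]
    simp only [hcubes, Finset.biUnion_singleton_eq_self]
  rw [Finset.union_biUnion, hDf.2, hWW]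
  exact Finset.sdiff_union_of_subset hW

/-- **THE (2.27)∘(2.32) LINK IS (2.27) ON THE AUGMENTED FAMILY** (kernel): on a (2.11)-geometry `Gk` whose cubes `c` are the
footprints of unit domains `unit c` (`cubes (unit c) = {c}`) of size `d_k(unit c) ≤ u₀`, for every domain `Z₀`, every uncovered cube
set `W ⊆ cubes Z₀` and every family `Df` covering `cubes Z₀ ∖ W` exactly:
`d_k(Z₀) + 5 ≤ Σ_{Y∈Df} (d_k Y + 5) + (5 + u₀)·#W` — the geometry's OWN (2.27) `Gk.ineq227 Z₀` (constant 5) applied to the augmented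
family of `augmented_mem_coveringFamilies`; each adjoined unit domain pays `d_k(unit c) + 5 ≤ u₀ + 5`.  No (2.32) is used: the LINK
binder `hlink` of N0u's `attachedPart_locE_le_of_coresAt_pencil_innerLabels` ∕ `innerCount_le` is thereby SUPPLIED at `c₃₂ := 5 + u₀`.
[folklore] -/
theorem link_of_ineq227 (unit : CubeK → Dk.Dom) (hcubes : ∀ c, Gk.cubes (unit c) = {c}) {u₀ : ℝ}
    (hu₀ : ∀ c, Dk.dj (unit c) ≤ u₀) (Z₀ : Dk.Dom) (W : Finset CubeK) (hW : W ⊆ Gk.cubes Z₀) (Df : Finset Dk.Dom)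
    (hDf : Df ∈ coveringFamilies Finset.univ Gk.cubes (Gk.cubes Z₀ \ W)) :
    Dk.dj Z₀ + 5 ≤ ∑ Y ∈ Df, (Dk.dj Y + 5) + (5 + u₀) * W.card := by
  classical
  have h227 : Dk.dj Z₀ + 5 ≤ ∑ Y ∈ Df ∪ W.image unit, (Dk.dj Y + 5) :=
    Gk.ineq227 Z₀ (Df ∪ W.image unit) (augmented_mem_coveringFamilies Gk unit hcubes hW hDf)
  -- split the sum over the union (the summands are nonnegative)
  have hnn : 0 ≤ ∑ Y ∈ Df ∩ W.image unit, (Dk.dj Y + 5) :=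
    Finset.sum_nonneg fun Y _ => by linarith [Dk.dj_nonneg Y]
  have hsplit : ∑ Y ∈ Df ∪ W.image unit, (Dk.dj Y + 5) ≤
      ∑ Y ∈ Df, (Dk.dj Y + 5) + ∑ Y ∈ W.image unit, (Dk.dj Y + 5) := by
    rw [← Finset.sum_union_inter]; linarith
  -- the adjoined unit domains are pairwise different (their footprints are different cubes) and each pays at most `u₀ + 5`
  have hinj : Set.InjOn unit ↑W := fun a _ b _ h => by
    have ha := hcubes a
    rw [h, hcubes b] at ha
    exact Finset.singleton_injective ha.symm
  have himg : ∑ Y ∈ W.image unit, (Dk.dj Y + 5) = ∑ c ∈ W, (Dk.dj (unit c) + 5) := Finset.sum_image hinj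
  have hW5 : ∑ c ∈ W, (Dk.dj (unit c) + 5) ≤ (5 + u₀) * W.card := by
    calc ∑ c ∈ W, (Dk.dj (unit c) + 5) ≤ ∑ _c ∈ W, (u₀ + 5) := Finset.sum_le_sum fun c _ => by linarith [hu₀ c]
      _ = (5 + u₀) * W.card := by rw [Finset.sum_const, nsmul_eq_mul]; ring
  linarith

/-- … the same link in the ARRANGEMENT the owner's N0v (`DressedSmallFieldOuterCount`, third∕fourth resummation steps, scale `k+1`
on the step geometry itself) displays it: `d_k(Z₀) − c'·#W + 5 ≤ Σ_{Y∈Df} (d_k Y + 5)` at `c' := 5 + u₀`. [folklore] -/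
theorem link_of_ineq227' (unit : CubeK → Dk.Dom) (hcubes : ∀ c, Gk.cubes (unit c) = {c}) {u₀ : ℝ}
    (hu₀ : ∀ c, Dk.dj (unit c) ≤ u₀) (Z₀ : Dk.Dom) (W : Finset CubeK) (hW : W ⊆ Gk.cubes Z₀) (Df : Finset Dk.Dom)
    (hDf : Df ∈ coveringFamilies Finset.univ Gk.cubes (Gk.cubes Z₀ \ W)) :
    Dk.dj Z₀ - (5 + u₀) * W.card + 5 ≤ ∑ Y ∈ Df, (Dk.dj Y + 5) := by
  have h := link_of_ineq227 Gk unit hcubes hu₀ Z₀ W hW Df hDf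
  linarith

end Link

/-! ## §2 ON pv22's TORUS: `c₃₂ = 5`, uniformly in the side `N` and the dimension `d`; and 5 is SHARP -/

section TorusLink

variable (d N : ℕ) [NeZero N]

/-- **THE LINK ON THE TORUS OF THE PAPERS AT `c₃₂ = 5`** (kernel; N0u's `hlink` SHAPE on `tsys d N` with footprints `Y ↦ Y.1`, NO
hypothesis): a single cube `{a}` IS a torus localization domain (non-empty, face-connected by reflexivity — the fact behind W24's
`isTDom_singleton`, re-derived inside the proof for every `d`) of tree length `0` (pv22's `torusTreeLen_singleton`), so §1 applies with
`u₀ = 0`: `torusTreeLen Z + 5 ≤ Σ_{Y∈Df} (torusTreeLen Y + 5) + 5·#W`. [folklore] -/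
theorem link_torus (Z : TDom d N) (W : Finset (TPt d N)) (hW : W ⊆ Z.1) (Df : Finset (TDom d N))
    (hDf : Df ∈ coveringFamilies Finset.univ (fun Y : TDom d N => Y.1) (Z.1 \ W)) :
    torusTreeLen Z.1 + 5 ≤ ∑ Y ∈ Df, (torusTreeLen Y.1 + 5) + 5 * W.card := by
  have hdom : ∀ a : TPt d N, IsTDom ({a} : Finset (TPt d N)) := fun a =>
    ⟨Finset.singleton_nonempty a, fun x hx y hy => by
      rw [Finset.mem_singleton] at hx hy; subst hx; subst hy; exact Relation.ReflTransGen.refl⟩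
  have h := link_of_ineq227 (tgeometry d N) (fun a => (⟨{a}, hdom a⟩ : TDom d N)) (fun _ => rfl) (u₀ := 0)
    (fun a => le_of_eq (torusTreeLen_singleton a)) Z W hW Df hDf
  have h5 : ((5 : ℝ) + 0) * W.card = 5 * W.card := by ring
  rw [h5] at h
  exact h

/-- … and in N0v's arrangement on the torus: `torusTreeLen Z − 5·#W + 5 ≤ Σ_{Y∈Df} (torusTreeLen Y + 5)`. [folklore] -/
theorem link_torus' (Z : TDom d N) (W : Finset (TPt d N)) (hW : W ⊆ Z.1) (Df : Finset (TDom d N))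
    (hDf : Df ∈ coveringFamilies Finset.univ (fun Y : TDom d N => Y.1) (Z.1 \ W)) :
    torusTreeLen Z.1 - 5 * W.card + 5 ≤ ∑ Y ∈ Df, (torusTreeLen Y.1 + 5) := by
  have h := link_torus d N Z W hW Df hDf
  linarith

/-- **THE CONSTANT 5 IS SHARP** for the link inequality AS TYPED [decided toy]: for any `c < 5` the inequality FAILS at a unit-cube
domain `{a}` with everything uncovered (`W = {a}`, `Df = ∅` — the empty family covers the empty footprint): it would read
`0 + 5 ≤ 0 + c·1`.  So N0u's `c₃₂` cannot be print's (2.32) constant `4` in the inequality as the cell types it (its `+5` is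
(2.27)'s), and §1's `5 + u₀` is attained at `u₀ = 0`. [folklore] -/
theorem link_torus_const_sharp (a : TPt d N) {c : ℝ} (hc : c < 5) :
    ¬ ∀ (Z : TDom d N) (W : Finset (TPt d N)), W ⊆ Z.1 →
        ∀ Df ∈ coveringFamilies Finset.univ (fun Y : TDom d N => Y.1) (Z.1 \ W),
          torusTreeLen Z.1 + 5 ≤ ∑ Y ∈ Df, (torusTreeLen Y.1 + 5) + c * W.card := by
  intro h
  have hdom : IsTDom ({a} : Finset (TPt d N)) :=
    ⟨Finset.singleton_nonempty a, fun x hx y hy => by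
      rw [Finset.mem_singleton] at hx hy; subst hx; subst hy; exact Relation.ReflTransGen.refl⟩
  have hmem : (∅ : Finset (TDom d N)) ∈
      coveringFamilies Finset.univ (fun Y : TDom d N => Y.1) ((⟨{a}, hdom⟩ : TDom d N).1 \ {a}) := by
    rw [mem_coveringFamilies]; simp
  have h1 := h ⟨{a}, hdom⟩ {a} subset_rfl ∅ hmem
  simp only [Finset.sum_empty, Finset.card_singleton, Nat.cast_one, mul_one, zero_add, torusTreeLen_singleton] at h1
  linarith

end TorusLink

/-! ## §3 N0u's INNER-LABEL END WITH THE LINK BINDER DISCHARGED (abstract geometry with unit domains) -/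

section End

variable {C : Carriers} {P : MeasPotFrame C} {Op : Type*} [NormedAddCommGroup Op] [NormedSpace ℂ Op] {Dk : LocDomainSys}
  {CubeK : Type} [DecidableEq CubeK] {Bnd : Type} [DecidableEq Bnd]
  {𝒴 : ℕ → (Σ _ : Finset CubeK, Finset Dk.Dom × Finset Bnd) → Type*} {dom : ∀ k i, 𝒴 k i → C.Dom}
  {β : ℕ → (Σ _ : Finset CubeK, Finset Dk.Dom × Finset Bnd) → Type*} [∀ k i, MeasurableSpace (β k i)]
  {α : ℕ → (Σ _ : Finset CubeK, Finset Dk.Dom × Finset Bnd) → Type*} [∀ k i, NormedAddCommGroup (α k i)]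
  [∀ k i, InnerProductSpace ℝ (α k i)] [∀ k i, FiniteDimensional ℝ (α k i)] [∀ k i, MeasurableSpace (α k i)]
  [∀ k i, BorelSpace (α k i)]
variable (D : LocDomainSys) {Cube : Type} [DecidableEq Cube] (G : Geometry D Cube) (Gk : Geometry Dk CubeK)

open Classical in
/-- **N0u's INNER-LABEL END WITHOUT THE LINK BINDER** (kernel; the owner's `attachedPart_locE_le_of_coresAt_pencil_innerLabels` ONCE BY
NAME, every binder VERBATIM except: `hlink ↦ (unit, hcubes, hu₀)` — the scale-`k` geometry's cubes are footprints of unit domains of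
size `≤ u₀` — supplied by §1's `link_of_ineq227`, and `c₃₂ ↦ 5 + u₀` inside the rate bookkeeping `hRR`
(`u := e^{R(5+u₀)}·s·e^{b₀t}`).  Displayed of (B3) exactly as N0u displays it otherwise: `hadm`, `hAmp`, `hb₀`∕`bondsOf`, the clauses.
Conclusion LITERALLY N0u's. [folklore] -/
theorem attachedPart_locE_le_of_coresAt_pencil_innerLabels_of_units {Win : Set (ℕ → ℝ)}
    {ctr : ℕ → (ℕ → ℝ) → C.BgB → Op × B13HistM P} {ROp RHist R' : ℕ → ℝ}
    (𝔊 : ∀ k i, C.Dom → BiCore P (dom k i) Op (β k i) (α k i))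
    {mq bq N₀ : ℕ → (Σ _ : Finset CubeK, Finset Dk.Dom × Finset Bnd) → C.Dom → ℝ}
    (hroom : ∀ k, ROp k < R' k)
    (hm : ∀ k, ∀ g ∈ Win, ∀ (U : C.BgB) (X : C.Dom), C.scale X = k → ∀ i, 0 < mq k i X)
    (hN : ∀ k, ∀ g ∈ Win, ∀ (U : C.BgB) (X : C.Dom), C.scale X = k → ∀ i,
      (∀ o ∈ ball (ctr k g U).1 (R' k), AEStronglyMeasurable ((𝔊 k i X).N o) (𝔊 k i X).lam) ∧
      (∀ p, DifferentiableOn ℂ (fun o => (𝔊 k i X).N o p) (ball (ctr k g U).1 (R' k))) ∧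
      (∀ o ∈ ball (ctr k g U).1 (R' k), ∀ p, ‖(𝔊 k i X).N o p‖ ≤ N₀ k i X))
    (hq : ∀ k, ∀ g ∈ Win, ∀ (U : C.BgB) (X : C.Dom), C.scale X = k → ∀ i,
      (∀ o ∈ ball (ctr k g U).1 (R' k),
        AEStronglyMeasurable (Function.uncurry ((𝔊 k i X).q o)) ((𝔊 k i X).lam.prod volume)) ∧
      (∀ p v, DifferentiableOn ℂ (fun o => (𝔊 k i X).q o p v) (ball (ctr k g U).1 (R' k))) ∧
      (∀ o ∈ ball (ctr k g U).1 (R' k), ∀ p v, mq k i X * ‖v‖ ^ 2 - bq k i X ≤ ((𝔊 k i X).q o p v).re))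
    {k : ℕ} {g : ℕ → ℝ} (hg : g ∈ Win) {U : C.BgB} {o : Op} {h₀ w : B13HistM P} {ϱ : ℝ}
    (hO : ‖o - (ctr k g U).1‖ ≤ ROp k) (hH : ‖h₀ - (ctr k g U).2‖ + ϱ * ‖w‖ ≤ RHist k)
    {emb : D.Dom → C.Dom} (hscale : ∀ Z, C.scale (emb Z) = k)
    {terms : D.Dom → Finset (Σ _ : Finset CubeK, Finset Dk.Dom × Finset Bnd)} {act : ℂ → D.Dom → ℂ}
    (hact : ∀ σ ∈ ball (0 : ℂ) ϱ, ∀ Z, act σ Z = ∑ i ∈ terms Z, (𝔊 k i (emb Z)).termAt o (h₀ + σ • w))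
    {A₀ A₁ Rkp r₁ b₅ : ℝ} {X₀ : D.Dom} (hA₀ : 0 ≤ A₀) (hA₁ : 0 ≤ A₁) (hr₁ : 0 ≤ r₁) (hb : r₁ * 5 ≤ b₅)
    (hrate : r₁ + 2 * G.κ₀ + 2 ≤ Rkp) (hsmall : (A₀ + ϱ * A₁) * Real.exp (b₅ + 1) * G.K₀ * G.ν * G.c₁ ≤ 1)
    (foot : D.Dom → Dk.Dom) (hmono : ∀ Z, D.dj Z ≤ Dk.dj (foot Z)) (bondsOf : Finset CubeK → Finset Bnd)
    {δ κ α₆ R b₀ s t : ℝ} (hα₆ : 0 ≤ α₆) (hκ : Gk.κ₀ + 1 ≤ δ * κ) (h229 : Real.exp 1 * Gk.K₀ * Gk.c₁ * α₆ ≤ 1)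
    (hs0 : 0 ≤ s) (hs1 : s ≤ 1) (ht : 0 ≤ t) (hb₀ : ∀ W, ((bondsOf W).card : ℝ) ≤ b₀ * W.card)
    (unit : CubeK → Dk.Dom) (hcubes : ∀ c, Gk.cubes (unit c) = {c}) {u₀ : ℝ} (hu₀ : ∀ c, Dk.dj (unit c) ≤ u₀)
    (hRR : Rkp ≤ R - Gk.c₁ * (Real.exp (R * (5 + u₀)) * s * Real.exp (b₀ * t)))
    (hadm : ∀ Z, ∀ l ∈ terms Z, l.1 ⊆ Gk.cubes (foot Z) ∧
      l.2.1 ∈ coveringFamilies Finset.univ Gk.cubes (Gk.cubes (foot Z) \ l.1) ∧ l.2.2 ⊆ bondsOf l.1 ∧ l.1.card ≤ 2 * l.2.2.card)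
    (hAmp : ∀ Z, G.cubes Z ⊆ G.cubes X₀ → ∀ l ∈ terms Z,
      (𝔊 k l (emb Z)).lam.real univ * ((𝔊 k l (emb Z)).wB * N₀ k l (emb Z) * Real.exp (bq k l (emb Z))) *
          (Real.pi / (mq k l (emb Z) / 2)) ^ (Module.finrank ℝ (α k l) / 2 : ℝ) *
        Real.exp ((𝔊 k l (emb Z)).N₁ * (‖h₀‖ + ϱ * ‖w‖)) ≤
      (A₀ + ϱ * A₁) * ((∏ Y ∈ l.2.1, (α₆ * Real.exp (-(δ * κ * Dk.dj Y)) * Real.exp (-(R * (Dk.dj Y + 5))))) *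
        (s ^ 2 * t) ^ l.2.2.card))
    (hϱ : 2 ≤ ϱ) (hϱA : A₀ ≤ ϱ * A₁) :
    ‖locE G.ι G.cubes (act 1) (G.cubes X₀) - locE G.ι G.cubes (act 0) (G.cubes X₀)‖ ≤
      4 * (Real.exp 1 * G.ν * G.c₁ * G.K₀ ^ 2) * A₁ * Real.exp (-(r₁ * D.dj X₀)) :=
  attachedPart_locE_le_of_coresAt_pencil_innerLabels D G Gk 𝔊 hroom hm hN hq hg hO hH hscale hact hA₀ hA₁ hr₁ hb hrate hsmall
    foot hmono bondsOf hα₆ hκ h229 hs0 hs1 ht hb₀ hRR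
    (fun Z W hW Df hDf => link_of_ineq227 Gk unit hcubes hu₀ (foot Z) W hW Df hDf) hadm hAmp hϱ hϱA

end End

/-! ## §4 ON THE TORUS OF THE PAPERS: NO link binder, NO geometry hypothesis, NO `hmono`; located numerals -/

section TorusEnd

variable {N : ℕ} [NeZero N]
variable {C : Carriers} {P : MeasPotFrame C} {Op : Type*} [NormedAddCommGroup Op] [NormedSpace ℂ Op] {Bnd : Type} [DecidableEq Bnd]
  {𝒴 : ℕ → (Σ _ : Finset (TPt 4 N), Finset (TDom 4 N) × Finset Bnd) → Type*} {dom : ∀ k i, 𝒴 k i → C.Dom}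
  {β : ℕ → (Σ _ : Finset (TPt 4 N), Finset (TDom 4 N) × Finset Bnd) → Type*} [∀ k i, MeasurableSpace (β k i)]
  {α : ℕ → (Σ _ : Finset (TPt 4 N), Finset (TDom 4 N) × Finset Bnd) → Type*} [∀ k i, NormedAddCommGroup (α k i)]
  [∀ k i, InnerProductSpace ℝ (α k i)] [∀ k i, FiniteDimensional ℝ (α k i)] [∀ k i, MeasurableSpace (α k i)]
  [∀ k i, BorelSpace (α k i)]

open Classical in
/-- **N0u's INNER-LABEL END ON THE TORUS OF THE PAPERS — NO LINK BINDER, NO GEOMETRY HYPOTHESIS** (kernel; §3 at `D = Dk :=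
tsys 4 N`, `G = Gk := tgeometry 4 N`, `foot := id` (`hmono` by `le_rfl`), unit domains the single cubes (`u₀ = 0`, so `c₃₂ = 5`),
pv22's located letters by N0o's `torus_consts` ∕ S24's `K₀_four`: `ν = 9`, `κ₀ = 64·log 162`, `c₁ = 64`, `K₀ = K₀(64,8)`,
`b₅ := 5·r₁`): the inner labels `⟨W, (𝐃, P)⟩` of a torus polymer `Z` (`W ⊆ Z`, `𝐃` covering `Z ∖ W` by torus domains, `P ⊆ bondsOf W`,
`#W ≤ 2·#P`), the per-label amplitude `hAmp`, the bonds-per-cube clause `hb₀`, and the clauses `64·log 162 + 1 ≤ δκ`,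
`e·K₀(64,8)·64·α₆ ≤ 1`, `r₁ + 2·(64 log 162) + 2 ≤ Rkp ≤ R − 64·(e^{5R}·s·e^{b₀t})`, `(A₀ + ϱA₁)·e^{5r₁+1}·K₀(64,8)·9·64 ≤ 1` stay
DISPLAYED; conclusion in the crew's torus currency `4·(e·9·64·K₀(64,8)²)·A₁·e^{−r₁·torusTreeLen X₀}`. [folklore] -/
theorem attachedPart_locE_le_of_coresAt_pencil_innerLabels_torus {Win : Set (ℕ → ℝ)}
    {ctr : ℕ → (ℕ → ℝ) → C.BgB → Op × B13HistM P} {ROp RHist R' : ℕ → ℝ}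
    (𝔊 : ∀ k i, C.Dom → BiCore P (dom k i) Op (β k i) (α k i))
    {mq bq N₀ : ℕ → (Σ _ : Finset (TPt 4 N), Finset (TDom 4 N) × Finset Bnd) → C.Dom → ℝ}
    (hroom : ∀ k, ROp k < R' k)
    (hm : ∀ k, ∀ g ∈ Win, ∀ (U : C.BgB) (X : C.Dom), C.scale X = k → ∀ i, 0 < mq k i X)
    (hN : ∀ k, ∀ g ∈ Win, ∀ (U : C.BgB) (X : C.Dom), C.scale X = k → ∀ i,
      (∀ o ∈ ball (ctr k g U).1 (R' k), AEStronglyMeasurable ((𝔊 k i X).N o) (𝔊 k i X).lam) ∧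
      (∀ p, DifferentiableOn ℂ (fun o => (𝔊 k i X).N o p) (ball (ctr k g U).1 (R' k))) ∧
      (∀ o ∈ ball (ctr k g U).1 (R' k), ∀ p, ‖(𝔊 k i X).N o p‖ ≤ N₀ k i X))
    (hq : ∀ k, ∀ g ∈ Win, ∀ (U : C.BgB) (X : C.Dom), C.scale X = k → ∀ i,
      (∀ o ∈ ball (ctr k g U).1 (R' k),
        AEStronglyMeasurable (Function.uncurry ((𝔊 k i X).q o)) ((𝔊 k i X).lam.prod volume)) ∧
      (∀ p v, DifferentiableOn ℂ (fun o => (𝔊 k i X).q o p v) (ball (ctr k g U).1 (R' k))) ∧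
      (∀ o ∈ ball (ctr k g U).1 (R' k), ∀ p v, mq k i X * ‖v‖ ^ 2 - bq k i X ≤ ((𝔊 k i X).q o p v).re))
    {k : ℕ} {g : ℕ → ℝ} (hg : g ∈ Win) {U : C.BgB} {o : Op} {h₀ w : B13HistM P} {ϱ : ℝ}
    (hO : ‖o - (ctr k g U).1‖ ≤ ROp k) (hH : ‖h₀ - (ctr k g U).2‖ + ϱ * ‖w‖ ≤ RHist k)
    {emb : (tsys 4 N).Dom → C.Dom} (hscale : ∀ Z, C.scale (emb Z) = k)
    {terms : (tsys 4 N).Dom → Finset (Σ _ : Finset (TPt 4 N), Finset (TDom 4 N) × Finset Bnd)}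
    {act : ℂ → (tsys 4 N).Dom → ℂ}
    (hact : ∀ σ ∈ ball (0 : ℂ) ϱ, ∀ Z, act σ Z = ∑ i ∈ terms Z, (𝔊 k i (emb Z)).termAt o (h₀ + σ • w))
    {A₀ A₁ Rkp r₁ : ℝ} (X₀ : (tsys 4 N).Dom) (hA₀ : 0 ≤ A₀) (hA₁ : 0 ≤ A₁) (hr₁ : 0 ≤ r₁)
    (hrate : r₁ + 2 * (64 * Real.log 162) + 2 ≤ Rkp)
    (hsmall : (A₀ + ϱ * A₁) * Real.exp (5 * r₁ + 1) * K₀ 64 8 * 9 * 64 ≤ 1)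
    (bondsOf : Finset (TPt 4 N) → Finset Bnd) {δ κ α₆ R b₀ s t : ℝ} (hα₆ : 0 ≤ α₆)
    (hκ : 64 * Real.log 162 + 1 ≤ δ * κ) (h229 : Real.exp 1 * K₀ 64 8 * 64 * α₆ ≤ 1)
    (hs0 : 0 ≤ s) (hs1 : s ≤ 1) (ht : 0 ≤ t) (hb₀ : ∀ W, ((bondsOf W).card : ℝ) ≤ b₀ * W.card)
    (hRR : Rkp ≤ R - 64 * (Real.exp (R * 5) * s * Real.exp (b₀ * t)))
    (hadm : ∀ Z : (tsys 4 N).Dom, ∀ l ∈ terms Z, l.1 ⊆ Z.1 ∧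
      l.2.1 ∈ coveringFamilies Finset.univ (fun Y : (tsys 4 N).Dom => Y.1) (Z.1 \ l.1) ∧ l.2.2 ⊆ bondsOf l.1 ∧
        l.1.card ≤ 2 * l.2.2.card)
    (hAmp : ∀ Z : (tsys 4 N).Dom, Z.1 ⊆ X₀.1 → ∀ l ∈ terms Z,
      (𝔊 k l (emb Z)).lam.real univ * ((𝔊 k l (emb Z)).wB * N₀ k l (emb Z) * Real.exp (bq k l (emb Z))) *
          (Real.pi / (mq k l (emb Z) / 2)) ^ (Module.finrank ℝ (α k l) / 2 : ℝ) *
        Real.exp ((𝔊 k l (emb Z)).N₁ * (‖h₀‖ + ϱ * ‖w‖)) ≤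
      (A₀ + ϱ * A₁) * ((∏ Y ∈ l.2.1, (α₆ * Real.exp (-(δ * κ * torusTreeLen Y.1)) *
        Real.exp (-(R * (torusTreeLen Y.1 + 5))))) * (s ^ 2 * t) ^ l.2.2.card))
    (hϱ : 2 ≤ ϱ) (hϱA : A₀ ≤ ϱ * A₁) :
    ‖locE (TTouch (d := 4) (N := N)) (fun Z : (tsys 4 N).Dom => Z.1) (act 1) X₀.1 -
        locE (TTouch (d := 4) (N := N)) (fun Z : (tsys 4 N).Dom => Z.1) (act 0) X₀.1‖ ≤
      4 * (Real.exp 1 * 9 * 64 * K₀ 64 8 ^ 2) * A₁ * Real.exp (-(r₁ * torusTreeLen X₀.1)) := by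
  obtain ⟨hν, hκ₀, hc⟩ := torus_consts N
  have hK₀ := K₀_four (N := N)
  have hdom : ∀ a : TPt 4 N, IsTDom ({a} : Finset (TPt 4 N)) := fun a =>
    ⟨Finset.singleton_nonempty a, fun x hx y hy => by
      rw [Finset.mem_singleton] at hx hy; subst hx; subst hy; exact Relation.ReflTransGen.refl⟩
  have h := attachedPart_locE_le_of_coresAt_pencil_innerLabels_of_units (tsys 4 N) (tgeometry 4 N) (tgeometry 4 N) 𝔊 hroom hm
    hN hq hg hO hH hscale hact (Rkp := Rkp) (b₅ := 5 * r₁) (X₀ := X₀) hA₀ hA₁ hr₁ (le_of_eq (by ring))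
    (by rw [hκ₀]; exact hrate) (by rw [hK₀, hν, hc]; exact hsmall) id (fun _ => le_rfl) bondsOf hα₆
    (by rw [hκ₀]; exact hκ) (by rw [hK₀, hc]; exact h229) hs0 hs1 ht hb₀
    (fun a => (⟨{a}, hdom a⟩ : TDom 4 N)) (fun _ => rfl) (u₀ := 0) (fun a => le_of_eq (torusTreeLen_singleton a))
    (by rw [hc, show (5 : ℝ) + 0 = 5 by norm_num]; exact hRR) hadm hAmp hϱ hϱA
  rw [hν, hc, hK₀] at h
  exact h

end TorusEnd

end Summit.QuantumFields.BalabanUV.T4Continuum.NE1p.DressedSmallFieldInnerLink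

end
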